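import Summits.CriticalPhenomena.PercolationContinuityZ3.Theorems.Transplant.SkelFrmBChoiceDefsV
import Summits.CriticalPhenomena.PercolationContinuityZ3.Theorems.Transplant.SkelFrm1ChoiceLTK
import HarnessLib

/-!
# N2 (frames-only node `SamePDropOfSkeletonFrm₁`, OPEN), (R) column: THE GLUE AT THE CHOICE FUNCTION OF RECORD UNDER THE K-FLOOR —
# `rootHoldsNQWFnLK_frmChoiceAllQ3V_of_axes`: `RootHoldsNQWFnLK Lf Kmin (frmChoiceAllQ3V gv fv Pv Sv cv hv bv)` FROM ONE ROOT LEG PER AXIS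

The V/K twin of `rootHoldsNQWFnL_frmChoiceAllQ3_of_axes` (SkelFrm1RootGlueQ p350528) for stmt-g21's SEVEN-slot choice function of record under
(R-44)/(R-45) `frmChoiceAllQ3V gv fv Pv Sv cv hv bv` (SkelFrmBChoiceDefsV) and the K-floor column Prop `RootHoldsNQWFnLK Lf Kmin` of the closure of
record `samePDropOfSkeletonFrm₁_of_choiceFnNQLTK` (SkelFrm1ChoiceLTK, (R-42)): by `Skel.rootOblTWF_of_axes` (SkelRootSeedLawF) the (R) Prop follows from
ONE root leg per axis `a : Fin 2` at the premise `AtQNQ`, GIVEN `Kmin ≤ κ.K₀` (handed to the legs: the thin instance reads `5 ≤ Kq` from it) and the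
flat table `FlatQ Lf κ` (rewrites `κ.δr n = κ.δr 0` for `n ≤ Lf κ.K₀`), each leg in the shape the (R) `_of_le` wrappers conclude
(`NegB.rootLegAt_frmQ3KV_fst_of_le` / `…_snd_of_le`: chain length EXPOSED and `≤ Lf κ.K₀`, every accuracy at `κ.δr 0`).
NON-VACUITY (lead g11 standing order): a re-packaging of the two legs; nothing assumed beyond its hypothesis `h`, which the thin instance discharges by
the two `_of_le` wrappers at stmt's tuple.
builds on p205010 (kernel theorem, internal audit signed; external expert review pending) — nothing in this file uses p205010; nothing here is a claim about
the open node `SamePDropOfSkeletonFrm₁`.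
Lane `prim-bschramm`, seat `prim-bschramm-p3` (gen 18; N2 design owner, (R) column owner); helper file (`--supports stmt-CriticalPhenomena-4575 --as helper`).
[cite: KozmaNitzan2024, §4 p. 28 ((32) at the root), Theorem 6 (pp. 25–31): the order of constants]
-/

noncomputable section

open scoped Classical

namespace Summit.CriticalPhenomena.PercolationContinuityZ3.Theorems.Transplant

open MeasureTheory Literature.Probability.Percolation Literature.Probability.LatticeModels SimpleGraph KNCells KNLevels

namespace PlanarSkeletonFrm

open SkelConc (Consts)
open Skelφ.StepI (OutNS)
open Skel (winGraph)

/-- **`RootHoldsNQWFnLK Lf Kmin (frmChoiceAllQ3V …)` FROM ONE ROOT LEG PER AXIS, length-budgeted, at the flat accuracy `κ.δr 0`, under the K-floor**: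
for every `(κ, G, Φ, t, p, hC, O, q)` with `Kmin ≤ κ.K₀` at the premise `AtQNQ` of the choices of record `NegB.choiceAtQ3V …`, given `Φ.types = {t}`,
`0 < p < 1` and the flat table `FlatQ Lf κ`, a root leg along each axis `a : Fin 2` — a linked chain of `n + 1 ≤ Lf κ.K₀ + 1` target steps in a window
graph under a law dominated by the pinned root law inside `Q₀ ∪ E_{0,(a,true)}`, (S0) kits / excess / source at `κ.δr 0`, last true target in
`M_{0+(a,true)}` — gives the (R) Prop of the closure of record under the K-floor. [cite: KozmaNitzan2024, §4 p. 28 ((32) at the root)] -/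
theorem rootHoldsNQWFnLK_frmChoiceAllQ3V_of_axes (Lf : ℕ → ℕ) (Kmin : ℕ) (gv fv : Neg.FSlot) (Pv : NegB.PSlot) (Sv : NegB.SSlot) (cv hv : NegB.CSlot) (bv : NegB.BSlot)
    (h : ∀ (κ : Consts) {V : Type} [DecidableEq V] [Countable V] (G : SimpleGraph V) [G.LocallyFinite] (Φ : PlanarSkeletonFrm G) (t : V) (p : unitInterval)
      (hC : Φ.CylSubcritical p) (O : OutNS V) (q : unitInterval), Kmin ≤ κ.K₀ → (NegB.choiceAtQ3V κ Φ t p Pv gv fv Sv cv hv bv hC).AtQNQ O q →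
      Φ.types = {t} → 0 < (p : ℝ) → (p : ℝ) < 1 → FlatQ Lf κ → ∀ a : Fin 2,
      ∃ n, n ≤ Lf κ.K₀ ∧ ∃ (c : V) (Rπ : ℕ) (W : Sym2 V → unitInterval) (s : Fin (n + 1) → KNLevels.TStep (winGraph G c Rπ))
        (T' : Fin (n + 1) → Finset V) (η : ℝ),
        (∀ T : Finset V, (prodBernoulli W).real (⋃ t' ∈ T, openConn (NegB.ΓQV κ Φ t p O gv fv Sv cv hv bv q).root t') ≤
          (prodBernoulli (pinW (KNLevels.lattW G q) ↑((⟨NegB.ΓQV κ Φ t p O gv fv Sv cv hv bv q, q, κ.δ⟩ : KSchA V ℕ).U₀ G)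
            ↑((⟨NegB.ΓQV κ Φ t p O gv fv Sv cv hv bv q, q, κ.δ⟩ : KSchA V ℕ).U₀ G))).real
            (⋃ t' ∈ (↑T : Set V), openConnIn (↑((NegB.ΓQV κ Φ t p O gv fv Sv cv hv bv q).Q (NegB.ΓQV κ Φ t p O gv fv Sv cv hv bv q).a₀ 0 ∪
              (NegB.ΓQV κ Φ t p O gv fv Sv cv hv bv q).Ewv (NegB.ΓQV κ Φ t p O gv fv Sv cv hv bv q).a₀ 0 ((a, true) : MDir)) : Set V)
              (NegB.ΓQV κ Φ t p O gv fv Sv cv hv bv q).root t')) ∧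
        (∀ i : Fin (n + 1), (s i).L.o = (NegB.ΓQV κ Φ t p O gv fv Sv cv hv bv q).root) ∧
        (∀ i : Fin n, T' (Fin.castSucc i) ⊆ (s i.succ).L.X 0) ∧ (∀ i : Fin (n + 1), T' i ⊆ (s i).T) ∧
        (∀ i : Fin (n + 1), (s i).KitsAtF W q Φ.Δ (κ.δr 0)) ∧ η ≤ κ.δr 0 / 2 ∧
        (∀ i : Fin (n + 1), (prodBernoulli W).real (⋃ t' ∈ (s i).T \ T' i, openConn (NegB.ΓQV κ Φ t p O gv fv Sv cv hv bv q).root t') ≤ η) ∧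
        1 - κ.δr 0 < (prodBernoulli W).real (s 0).L.reachB ∧
        T' (Fin.last n) ⊆ (NegB.ΓQV κ Φ t p O gv fv Sv cv hv bv q).M (NegB.ΓQV κ Φ t p O gv fv Sv cv hv bv q).a₀ ((0 : Site 2) + stepVec ((a, true) : MDir))) :
    RootHoldsNQWFnLK Lf Kmin (frmChoiceAllQ3V gv fv Pv Sv cv hv bv) := by
  intro κ V _ _ G _ Φ hg t ht h1 p hp0 hp1 hC hK hflat O q hAt
  rw [frmChoiceAllQ3V_eq] at hAt
  rw [frmChoiceAllQ3V_scheme]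
  refine Skel.rootOblTWF_of_axes fun a => ?_
  obtain ⟨n, hn, c, Rπ, W, s, T', η, htr, ho, hlink, hsub, hkits, hη, hexc, hsrc, hlast⟩ := h κ G Φ t p hC O q hK hAt h1 hp0 hp1 hflat a
  refine ⟨n, c, Rπ, W, s, T', η, htr, ho, hlink, hsub, ?_, ?_, hexc, ?_, hlast⟩
  · rw [hflat n hn]; exact hkits
  · rw [hflat n hn]; exact hη
  · rw [hflat n hn]; exact hsrc

end PlanarSkeletonFrm

end Summit.CriticalPhenomena.PercolationContinuityZ3.Theorems.Transplant

end
-- build-touch 2026-08-25T06:21:31Z T1-A (lead g18): re-land of p391776, declarations byte-identical
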